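import Summits.NavierStokesRegularity.NavierStokesRegularity.Theorems.EulerZoomLiouvillePowerGaugeEulerLiouvillePowerClockRigidity
import Summits.NavierStokesRegularity.NavierStokesRegularity.Theorems.EulerZoomLiouvillePowerGaugeEulerLiouvilleEnergySaturationSlowRate
import Summits.NavierStokesRegularity.NavierStokesRegularity.Theorems.EulerZoomLiouvillePowerGaugeEulerLiouvilleSelfSimilarSlowClockPast

/-!
# Crux `EulerZoomLiouville.PowerGaugeEulerLiouville` (stmt-NavierStokesRegularity-19832), line `logtime-breathers` (T4):
# classical SLOW power clocks (`0 < γ < 2/5`) about any `T₀ ≥ 0` are trivial, u-only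

Width seat `ns-ezl-w4` (power-clock rigidity, file V; sequel of `…PowerClockRigidity`).  The large-scale class data of a classical
power clock about `T₀ ≥ 0` (`PowerClockRigidity.exists_locData`, with the AVERAGED slice pressure — no pressure hypothesis) and the
classical local energy equality with exponent `γ` (`ClassicalProfile.local_energy_equality`, `(α, β) = (1−γ, γ)`) feed the slow-rate
absorption `EnergySaturation.ae_eq_zero_of_slowRate_loc` (`ρ' = 1/γ − 2 > ½ ⟺ γ < 2/5`):
`ae_eq_zero_of_gauge_of_classicalSlowPowerClock` — crux hypotheses (`0 < ρ ≤ ½`) + `(u, p)` classical + `u(τ, y) =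
(T₀−τ)^{γ−1} W((T₀−τ)^{−γ} y)` (`τ < 0`, `T₀ ≥ 0`, `0 < γ < 2/5`) ⇒ `u = 0` a.e.  (The tree's `SlowClock.selfSimilar_ae_eq_zero_of_slow_rate_past`
needs the pressure to be co-self-similar; `PastShape…slowPowerClock` needs `T₀ = 0`.)  With `…PowerClockRigidity` (`1/(2+ρ) < γ ≤ 2/3`)
and the fast clocks (`γ > ½ − ρ/5`, `…PastFastClock`), the classical power clocks about `T₀ > 0` that remain are `2/5 ≤ γ ≤ 1/(2+ρ)`.

WHAT THIS IS NOT: not NS regularity, not the crux — a sub-stratum of T4 on the MODEL lattice; `--supports` stmt-19832. [folklore]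
-/

noncomputable section

set_option linter.dupNamespace false

open MeasureTheory Set Filter Topology Metric Function TopologicalSpace
open scoped ENNReal NNReal RealInnerProductSpace ContDiff Laplacian

namespace Summit.NavierStokesRegularity.NavierStokesRegularity.Theorems.PowerGaugeEulerLiouville

open Literature.Analysis Literature.Analysis.FunctionSpaces Literature.Analysis.FluidPDE

namespace PowerClockRigidity

variable {u : ℝ → EuclideanSpace ℝ (Fin 3) → EuclideanSpace ℝ (Fin 3)} {p : ℝ → EuclideanSpace ℝ (Fin 3) → ℝ}
  {H : ℝ → EuclideanSpace ℝ (Fin 3) → EuclideanSpace ℝ (Fin 3) →L[ℝ] EuclideanSpace ℝ (Fin 3)}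
  {T₀ g : ℝ} {W : EuclideanSpace ℝ (Fin 3) → EuclideanSpace ℝ (Fin 3)}

/-- **CLASSICAL SLOW POWER CLOCKS ABOUT ANY `T₀ ≥ 0` ARE TRIVIAL.**  Crux hypotheses (weak spatial gradient `H`, the three power
gauges, `0 < ρ ≤ ½`) + `(u, p)` classical Euler on `(−∞, 0) × ℝ³` + `u(τ, y) = (T₀−τ)^{γ−1} W((T₀−τ)^{−γ} y)` for all `τ < 0` with `T₀ ≥ 0`,
`0 < γ < 2/5` ⇒ `u = 0` a.e. on `(−∞,0) × ℝ³` — no hypothesis on the profile or the pressure. [folklore] -/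
theorem ae_eq_zero_of_gauge_of_classicalSlowPowerClock {ρ : ℝ} (hρ : 0 < ρ) (hρh : ρ ≤ 1 / 2) {c₀ : ℝ≥0}
    (hH : HasWeakSpatialGradientOn (slab (EuclideanSpace ℝ (Fin 3)) (Iio 0) isOpen_Iio) u H)
    (hgauge : ∀ a : ℝ, 0 < a →
      ENNReal.ofReal (a ^ (2 * ρ)) * cknA a (0 : ℝ × EuclideanSpace ℝ (Fin 3)) u +
          ENNReal.ofReal (a ^ ρ) * cknE a (0 : ℝ × EuclideanSpace ℝ (Fin 3)) H +
        ENNReal.ofReal (a ^ (2 * ρ)) * cknD a (0 : ℝ × EuclideanSpace ℝ (Fin 3)) p ≤ (c₀ : ℝ≥0∞))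
    (hcl : IsClassicalEulerSolutionOn (Iio 0) 0 u p) (hT₀ : 0 ≤ T₀) (hg0 : 0 < g) (hg : g < 2 / 5)
    (hW : ∀ τ : ℝ, τ < 0 → ∀ y, u τ y = (T₀ - τ) ^ (g - 1) • W ((T₀ - τ) ^ (-g) • y)) :
    uncurry u =ᵐ[volume.restrict (Iio (0 : ℝ) ×ˢ (univ : Set (EuclideanSpace ℝ (Fin 3))))] 0 := by
  have hρ1 : ρ < 1 := by linarith
  obtain ⟨P, c', hP1, heq, hA, hE, hD⟩ :=
    exists_locData hρ hρh hH hgauge hcl hT₀ hg0.le (by linarith) hW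
  obtain ⟨hρ'h, -, hginv⟩ := SlowClock.slow_exponent_facts hg0 hg
  have hW1 : ContDiff ℝ 1 W := (PowerClock.contDiff_profile hcl hT₀ hW).of_le (by norm_num)
  have hWc : Continuous W := hW1.continuous
  have hdiv := PowerClock.isDivFree_profile hcl hT₀ hW
  have hVm : AEStronglyMeasurable W volume := hWc.aestronglyMeasurable
  have hPm : AEStronglyMeasurable P volume := hP1.continuous.aestronglyMeasurable
  have hGm : AEStronglyMeasurable (fderiv ℝ W) volume := (hW1.continuous_fderiv one_ne_zero).aestronglyMeasurable
  have hVG : HasWeakFDerivOn (⊤ : Opens (EuclideanSpace ℝ (Fin 3))) volume W (fderiv ℝ W) :=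
    hasWeakGradient_fderiv_of_contDiff hW1
  have hPoisson : ∀ θ : EuclideanSpace ℝ (Fin 3) → ℝ, ContDiff ℝ (⊤ : ℕ∞) θ → HasCompactSupport θ →
      ∫ y, P y * (Δ θ) y = -∫ y, fderiv ℝ (fderiv ℝ θ) y (W y) (W y) :=
    fun θ hθ hθc => ClassicalProfile.pressure_poisson hW1 hP1 hdiv heq (hθ.of_le (by norm_cast)) hθc
  have hEE : ∀ θ : EuclideanSpace ℝ (Fin 3) → ℝ, IsTestFunctionOn (⊤ : Opens (EuclideanSpace ℝ (Fin 3))) θ →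
      (2 - 5 * (1 / (2 + (1 / g - 2)))) * ∫ x, θ x * ‖W x‖ ^ 2 =
        (∫ x, (‖W x‖ ^ 2 + 2 * P x) * ⟪W x, gradient θ x⟫) +
          (1 / (2 + (1 / g - 2))) * ∫ x, ‖W x‖ ^ 2 * ⟪x, gradient θ x⟫ := by
    intro θ hθ
    rw [hginv]
    have h := ClassicalProfile.local_energy_equality hW1 hP1 hdiv heq (hθ.contDiff.of_le (by exact_mod_cast le_top))
      hθ.hasCompactSupport
    have h5 : (2 * (1 - g) - 3 * g) = 2 - 5 * g := by ring
    rw [h5] at h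
    exact h
  have hWae : W =ᵐ[volume] 0 :=
    EnergySaturation.ae_eq_zero_of_slowRate_loc (ρ' := 1 / g - 2) hρ hρ1 hρ'h hVm hPm hGm hVG hA hE hD hPoisson hEE
  have hW0 : W = 0 := (Continuous.ae_eq_iff_eq volume hWc continuous_const).1 hWae
  filter_upwards [ae_restrict_mem (measurableSet_Iio.prod MeasurableSet.univ)] with q hq
  rw [mem_prod, mem_Iio] at hq
  show u q.1 q.2 = 0
  rw [hW q.1 hq.1 q.2, hW0, Pi.zero_apply, smul_zero]

end PowerClockRigidity

end Summit.NavierStokesRegularity.NavierStokesRegularity.Theorems.PowerGaugeEulerLiouville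

end
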